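import Summits.QuantumAdvantage.QuantumAdvantage.Theorems.SosSandwichPseudoBoundedAAClassicalCornerL2OSSSNoGoPrep
import Literature.Computability.Complexity.BooleanFourier
import Literature.Computability.Complexity.HuangMatrix
import HarnessLib

/-!
# Crux `PseudoBoundedAA` (stmt-QuantumAdvantage-15237, route SosSandwich) — classical corner: a tree's Fourier
# coefficient on `S` is at most the probability that it reads all of `S`; for mixtures, `|S|·|p̂(S)| ≤ δ̄(S)`

Support file (`--supports stmt-QuantumAdvantage-15237`).  The two no-go theorems of this generation
(`…ClassicalCornerL2OSSSNoGo.lean`, `…ClassicalCornerL2OSSSNoGoBalanced.lean`) show that the census's `L²`-OSSS law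
`16 Var[p]² ≤ C₀ Σⱼ δ̄ⱼ Infⱼ[p]` on the classical corner `R_T` (mixtures `p = Σ_k w_k[t_k accepts]` of decision trees)
cannot come from any PER-TREE bilinear bound: a proof must use that `p` is the mixture of the SAME trees whose query
probabilities enter `δ̄`.  This file records the first such MIXTURE-AWARE inequality, in Fourier language
(`Literature.Computability.Complexity.LowDegree.cubeFourierCoeff`, `walsh`):

* **`abs_sum_mul_walsh_le_card_queries`** — for a decision tree `t` (arbitrary, possibly re-querying) with `0/1` output
  `F` and every `S`: `|Σₓ F(x) χ_S(x)| ≤ #{x : S ⊆ t.queries x}`, i.e. `|F̂(S)| ≤ Pr_x[t reads every coordinate of S]`.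
  Proof: on the inputs where some coordinate of `S` is NOT read, flipping the least such coordinate is an involution that
  preserves the path (hence `F` and the query set) and negates `χ_S` (`Finset.sum_involution`); the remaining inputs
  contribute at most `1` each.
* **`card_mul_abs_sum_mixture_walsh_le`** — for a nonnegative mixture `P = Σ_k w_k F_k`:
  `|S| · |Σₓ P χ_S| ≤ Σ_{j∈S} Σ_k w_k #{x : j ∈ t_k.queries x}`, i.e. **`|S|·|P̂(S)| ≤ δ̄(S) := Σ_{j∈S} δ̄ⱼ`**
  (`card_mul_abs_cubeFourierCoeff_le`, normalised): the mixture's Fourier mass can only sit where the mixture itself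
  queries.  (Contrast: for a single balanced tree nothing bounds `F̂(S)²/δ_t(S)` summably — `not_exists_bilinear_osss`.)

Honest label: a structural lemma for the classical corner of an open conjecture (folklore strength: decision trees have
Fourier support on root-to-leaf paths, Kushilevitz–Mansour / O'Donnell §3.4); no stub, crux or summit is closed.
Sources: R. O'Donnell, *Analysis of Boolean Functions* (2014) §3.4 (spectral structure of decision trees), §8.6;
E. Kushilevitz, Y. Mansour, SIAM J. Comput. 22 (1993).
-/

set_option linter.dupNamespace false

noncomputable section

namespace Summit.QuantumAdvantage.QuantumAdvantage.Theorems.SosSandwich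

open Finset Function
open Literature.Computability.Complexity
open Literature.Probability.RandomGraphs.LowDegree (walsh sgn)
open Literature.Computability.Complexity.LowDegree (cubeFourierCoeff)

namespace ClassicalCornerFourierQueries

variable {N : ℕ}

/-- Flipping a coordinate of `S` negates the character `χ_S`. [cite: ODonnell2014, §1.4] -/
theorem walsh_update_not {S : Finset (Fin N)} {i : Fin N} (hi : i ∈ S) (x : Fin N → Bool) :
    walsh S (update x i (!x i)) = -walsh S x := by
  unfold walsh
  rw [← Finset.mul_prod_erase S _ hi, ← Finset.mul_prod_erase S (fun j => sgn (x j)) hi, update_self]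
  have hrest : ∏ j ∈ S.erase i, sgn (update x i (!x i) j) = ∏ j ∈ S.erase i, sgn (x j) :=
    Finset.prod_congr rfl fun j hj => by rw [update_of_ne (Finset.ne_of_mem_erase hj)]
  rw [hrest]
  cases x i <;> simp [sgn]

/-- **A decision tree's Fourier coefficient on `S` is at most the probability that it reads all of `S`.**  For a
decision tree `t` with `0/1` output `F` and any `S`: `|Σₓ F(x)·χ_S(x)| ≤ #{x : S ⊆ t.queries x}` (un-normalised;
`|F̂(S)| ≤ Pr_x[S ⊆ t.queries x]`).  Inputs on which some coordinate of `S` is unread cancel in pairs under flipping the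
least unread coordinate of `S` (same path, same output, opposite character). [cite: ODonnell2014, §3.4] -/
theorem abs_sum_mul_walsh_le_card_queries (t : DecisionTree N) (F : (Fin N → Bool) → ℝ)
    (hF : ∀ x, F x = if t.eval x = true then (1 : ℝ) else 0) (S : Finset (Fin N)) :
    |∑ x, F x * walsh S x| ≤ ((Finset.univ.filter fun x : Fin N → Bool => S ⊆ t.queries x).card : ℝ) := by
  classical
  -- split the cube according to whether `S` is entirely read
  rw [← Finset.sum_filter_add_sum_filter_not Finset.univ (fun x : Fin N → Bool => S ⊆ t.queries x)]
  -- the unread part cancels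
  have hcancel : ∑ x ∈ Finset.univ.filter (fun x : Fin N → Bool => ¬ S ⊆ t.queries x), F x * walsh S x = 0 := by
    -- the least unread coordinate of `S`
    have hne : ∀ x ∈ Finset.univ.filter (fun x : Fin N → Bool => ¬ S ⊆ t.queries x),
        (S \ t.queries x).Nonempty := by
      intro x hx
      rw [Finset.mem_filter] at hx
      obtain ⟨j, hjS, hjq⟩ := Finset.not_subset.mp hx.2
      exact ⟨j, Finset.mem_sdiff.mpr ⟨hjS, hjq⟩⟩
    refine Finset.sum_involution (fun x hx => update x ((S \ t.queries x).min' (hne x hx))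
      (!x ((S \ t.queries x).min' (hne x hx)))) ?_ ?_ ?_ ?_
    · -- `f x + f (g x) = 0`
      intro x hx
      have hmin := Finset.min'_mem _ (hne x hx)
      rw [Finset.mem_sdiff] at hmin
      rw [hF, hF, DecisionTree.eval_update_of_not_mem_queries t x hmin.2, walsh_update_not hmin.1]
      ring
    · -- `g x ≠ x`
      intro x hx _ heq
      have := congr_fun heq ((S \ t.queries x).min' (hne x hx))
      rw [update_self] at this
      exact Bool.not_ne_self _ this
    · -- `g x ∈ s`
      intro x hx
      have hmin := Finset.min'_mem _ (hne x hx)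
      rw [Finset.mem_sdiff] at hmin
      rw [Finset.mem_filter] at hx ⊢
      refine ⟨Finset.mem_univ _, ?_⟩
      rw [(DecisionTree.queries_update_of_not_mem t x hmin.2 _).1]
      exact hx.2
    · -- involution
      intro x hx
      have hmin := Finset.min'_mem _ (hne x hx)
      rw [Finset.mem_sdiff] at hmin
      have hq : t.queries (update x ((S \ t.queries x).min' (hne x hx)) (!x ((S \ t.queries x).min' (hne x hx))))
          = t.queries x := (DecisionTree.queries_update_of_not_mem t x hmin.2 _).1
      have hidx : (S \ t.queries (update x ((S \ t.queries x).min' (hne x hx))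
          (!x ((S \ t.queries x).min' (hne x hx))))).min'
            (hne _ (by rw [Finset.mem_filter]; exact ⟨Finset.mem_univ _, by rw [hq]; exact (Finset.mem_filter.mp hx).2⟩))
          = (S \ t.queries x).min' (hne x hx) := by
        congr 1
        rw [hq]
      rw [hidx]
      simp
  rw [hcancel, add_zero]
  -- the read part: each term has absolute value at most `1`
  calc |∑ x ∈ Finset.univ.filter (fun x : Fin N → Bool => S ⊆ t.queries x), F x * walsh S x|
      ≤ ∑ x ∈ Finset.univ.filter (fun x : Fin N → Bool => S ⊆ t.queries x), |F x * walsh S x| :=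
        Finset.abs_sum_le_sum_abs _ _
    _ ≤ ∑ _x ∈ Finset.univ.filter (fun x : Fin N → Bool => S ⊆ t.queries x), (1 : ℝ) := by
        refine Finset.sum_le_sum fun x _ => ?_
        rw [abs_mul, Literature.Computability.Complexity.abs_walsh, mul_one, hF]
        split_ifs <;> simp
    _ = ((Finset.univ.filter fun x : Fin N → Bool => S ⊆ t.queries x).card : ℝ) := by
        rw [Finset.sum_const, nsmul_eq_mul, mul_one]

/-- Normalised form: `|F̂(S)| ≤ Pr_x[S ⊆ t.queries x]`. [cite: ODonnell2014, §3.4] -/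
theorem abs_cubeFourierCoeff_le_prob_queries (t : DecisionTree N) (F : (Fin N → Bool) → ℝ)
    (hF : ∀ x, F x = if t.eval x = true then (1 : ℝ) else 0) (S : Finset (Fin N)) :
    |cubeFourierCoeff F S| ≤
      ((Finset.univ.filter fun x : Fin N → Bool => S ⊆ t.queries x).card : ℝ) / (2 : ℝ) ^ N := by
  unfold cubeFourierCoeff
  rw [abs_div, abs_of_pos (by positivity : (0 : ℝ) < 2 ^ N)]
  exact div_le_div_of_nonneg_right (abs_sum_mul_walsh_le_card_queries t F hF S) (by positivity)

/-- Reading all of `S` is rarer than reading any one `j ∈ S`. [folklore] -/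
theorem card_subset_queries_le (t : DecisionTree N) {S : Finset (Fin N)} {j : Fin N} (hj : j ∈ S) :
    ((Finset.univ.filter fun x : Fin N → Bool => S ⊆ t.queries x).card : ℝ) ≤
      ((Finset.univ.filter fun x : Fin N → Bool => j ∈ t.queries x).card : ℝ) := by
  classical
  exact_mod_cast Finset.card_le_card fun x hx => by
    rw [Finset.mem_filter] at hx ⊢
    exact ⟨hx.1, hx.2 hj⟩

/-- **Mixture-aware Fourier bound: `|S|·|P̂(S)| ≤ δ̄(S)`.**  If `P = Σ_{k∈s} w_k·[t_k accepts]` on the cube with `w_k ≥ 0`,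
then `|S| · |Σₓ P(x) χ_S(x)| ≤ Σ_{j∈S} Σ_k w_k #{x : j ∈ t_k.queries x}` — the mixture's Fourier mass on `S` is paid
for by the mixture's own query probabilities of the coordinates of `S`. [folklore] -/
theorem card_mul_abs_sum_mixture_walsh_le {ι : Type*} (s : Finset ι) (w : ι → ℝ) (hw : ∀ k ∈ s, 0 ≤ w k)
    (t : ι → DecisionTree N) (P : (Fin N → Bool) → ℝ)
    (hP : ∀ x, P x = ∑ k ∈ s, w k * (if (t k).eval x = true then (1 : ℝ) else 0)) (S : Finset (Fin N)) :
    (S.card : ℝ) * |∑ x, P x * walsh S x| ≤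
      ∑ j ∈ S, ∑ k ∈ s, w k * ((Finset.univ.filter fun x : Fin N → Bool => j ∈ (t k).queries x).card : ℝ) := by
  classical
  -- linearity: `Σ P χ_S = Σ_k w_k Σ F_k χ_S`
  have hlin : ∑ x, P x * walsh S x =
      ∑ k ∈ s, w k * ∑ x, (if (t k).eval x = true then (1 : ℝ) else 0) * walsh S x := by
    calc ∑ x, P x * walsh S x = ∑ x, ∑ k ∈ s, w k * ((if (t k).eval x = true then (1 : ℝ) else 0) * walsh S x) := by
          refine Finset.sum_congr rfl fun x _ => ?_
          rw [hP x, Finset.sum_mul]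
          exact Finset.sum_congr rfl fun k _ => by ring
      _ = ∑ k ∈ s, ∑ x, w k * ((if (t k).eval x = true then (1 : ℝ) else 0) * walsh S x) := Finset.sum_comm
      _ = ∑ k ∈ s, w k * ∑ x, (if (t k).eval x = true then (1 : ℝ) else 0) * walsh S x :=
          Finset.sum_congr rfl fun k _ => by rw [Finset.mul_sum]
  -- per tree: `|S|·|Σ F_k χ_S| ≤ Σ_{j∈S} W^k_j`
  have hk : ∀ k, (S.card : ℝ) * |∑ x, (if (t k).eval x = true then (1 : ℝ) else 0) * walsh S x| ≤
      ∑ j ∈ S, ((Finset.univ.filter fun x : Fin N → Bool => j ∈ (t k).queries x).card : ℝ) := by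
    intro k
    have hb := abs_sum_mul_walsh_le_card_queries (t k) _ (fun x => rfl) S
    calc (S.card : ℝ) * |∑ x, (if (t k).eval x = true then (1 : ℝ) else 0) * walsh S x|
        ≤ (S.card : ℝ) * ((Finset.univ.filter fun x : Fin N → Bool => S ⊆ (t k).queries x).card : ℝ) :=
          mul_le_mul_of_nonneg_left hb (Nat.cast_nonneg _)
      _ = ∑ _j ∈ S, ((Finset.univ.filter fun x : Fin N → Bool => S ⊆ (t k).queries x).card : ℝ) := by
          rw [Finset.sum_const, nsmul_eq_mul]
      _ ≤ ∑ j ∈ S, ((Finset.univ.filter fun x : Fin N → Bool => j ∈ (t k).queries x).card : ℝ) :=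
          Finset.sum_le_sum fun j hj => card_subset_queries_le (t k) hj
  rw [hlin]
  calc (S.card : ℝ) * |∑ k ∈ s, w k * ∑ x, (if (t k).eval x = true then (1 : ℝ) else 0) * walsh S x|
      ≤ (S.card : ℝ) * ∑ k ∈ s, |w k * ∑ x, (if (t k).eval x = true then (1 : ℝ) else 0) * walsh S x| :=
        mul_le_mul_of_nonneg_left (Finset.abs_sum_le_sum_abs _ _) (Nat.cast_nonneg _)
    _ = ∑ k ∈ s, w k * ((S.card : ℝ) * |∑ x, (if (t k).eval x = true then (1 : ℝ) else 0) * walsh S x|) := by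
        rw [Finset.mul_sum]
        refine Finset.sum_congr rfl fun k hk' => ?_
        rw [abs_mul, abs_of_nonneg (hw k hk')]
        ring
    _ ≤ ∑ k ∈ s, w k * ∑ j ∈ S, ((Finset.univ.filter fun x : Fin N → Bool => j ∈ (t k).queries x).card : ℝ) :=
        Finset.sum_le_sum fun k hk' => mul_le_mul_of_nonneg_left (hk k) (hw k hk')
    _ = ∑ j ∈ S, ∑ k ∈ s, w k * ((Finset.univ.filter fun x : Fin N → Bool => j ∈ (t k).queries x).card : ℝ) := by
        rw [Finset.sum_comm]
        exact Finset.sum_congr rfl fun k _ => by rw [Finset.mul_sum]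

/-- Normalised form: **`|S| · |P̂(S)| ≤ δ̄(S) = Σ_{j∈S} δ̄ⱼ`**, `δ̄ⱼ = Σ_k w_k #{x : j ∈ t_k.queries x}/2^N`. [folklore] -/
theorem card_mul_abs_cubeFourierCoeff_le {ι : Type*} (s : Finset ι) (w : ι → ℝ) (hw : ∀ k ∈ s, 0 ≤ w k)
    (t : ι → DecisionTree N) (P : (Fin N → Bool) → ℝ)
    (hP : ∀ x, P x = ∑ k ∈ s, w k * (if (t k).eval x = true then (1 : ℝ) else 0)) (S : Finset (Fin N)) :
    (S.card : ℝ) * |cubeFourierCoeff P S| ≤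
      ∑ j ∈ S, ∑ k ∈ s, w k *
        (((Finset.univ.filter fun x : Fin N → Bool => j ∈ (t k).queries x).card : ℝ) / (2 : ℝ) ^ N) := by
  have h2N : (0 : ℝ) < (2 : ℝ) ^ N := by positivity
  unfold cubeFourierCoeff
  rw [abs_div, abs_of_pos h2N, ← mul_div_assoc, div_le_iff₀ h2N, Finset.sum_mul]
  refine (card_mul_abs_sum_mixture_walsh_le s w hw t P hP S).trans (le_of_eq ?_)
  refine Finset.sum_congr rfl fun j _ => ?_
  rw [Finset.sum_mul]
  refine Finset.sum_congr rfl fun k _ => ?_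
  field_simp

end ClassicalCornerFourierQueries

end Summit.QuantumAdvantage.QuantumAdvantage.Theorems.SosSandwich

end
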